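import Mathlib
import Summits.Ventures.HodgeRepro.Tier4.Common.ThetaLift
import Summits.Ventures.HodgeRepro.Tier4.Line4.ThetaRungs

/-!
# Tier4/Line4/ThetaEquivariance — the `χ̄′`-equivariance of a theta lift is a THEOREM from the DIAGONAL invariance
of its kernel (the Riesz-vector argument of L4-MATH.md §11 on the typed objects), and rung W1 / the wall W3 with the
kernel-level hypothesis

Blind re-derivation cell `pub-hodge-repro`, Tier 4 «prove the step» (README §9–§10), seat t4-L4-p1 (gen 2).  Tree path
`lean/Summits/Ventures/HodgeRepro/Tier4/Line4/ThetaEquivariance.lean`.  Imports `Line4/ThetaRungs.lean` (W1 / W3 on the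
theta vocabulary with the equivariance of the lift DISPLAYED) and typer-2's `Common/ThetaLift.lean`.

THE ARGUMENT.  For the printed seesaw kernel `K_Φ(t′, g) = ∫_{[U(2,1)]} Θ(h, g; Φ) \bar Θ(h, t′; Φ) dh` and a Schwartz
function `Φ` invariant under `ω(c)`, `c ∈ T′ ⊂ U(U)` (average any `Φ` over the compact `[T′]`), the kernel is
DIAGONALLY invariant: `K(t′ c, g c) = K(t′, g)`.  Then the lift `θ(χ̄′)(g) = ∫_{D_{T′}} K(t, g) χ̄′(t) dt` satisfies
`θ(χ̄′)(g c) = ∫_D K(t c⁻¹, g) χ̄′(t) dt = χ̄′(c) ∫_D K(t c⁻¹, g) χ̄′(t c⁻¹) dt = χ̄′(c) ∫_{D c⁻¹} K(s, g) χ̄′(s) ds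
= χ̄′(c) θ(χ̄′)(g)` — the change of variables `t ↦ t c⁻¹` (right invariance of the Haar measure of the ABELIAN torus)
and the fact that `D c⁻¹` is again a fundamental domain of `T′(k)` (the right translation commutes with the left
action) on which the `T′(k)`-invariant integrand has the same integral (`IsFundamentalDomain.setIntegral_eq`).

WHAT IS PROVED.  `countable_rationalOf` (the rational points of any subgroup of `G(𝔸_k)` are countable — from
`NumberField`, no hypothesis); `isFundamentalDomain_image_mulRight` (right translates of a fundamental domain are
fundamental domains); `setIntegral_mul_right_of_fundamentalDomain` (the change of variables on `[T′]` for a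
`T′(k)`-invariant integrand); **`thetaLift_mul_torus_of_diag`**: `Θ(t c, g c) = Θ(t, g)` for all `t, c ∈ T′(𝔸)`,
`g ∈ G(𝔸)` ⟹ `θ(χ̄′)(x c) = χ̄′(c) θ(χ̄′)(x)`; hence `isRieszVector_thetaLift_of_diag` and the rungs
`exists_admissible_riesz_of_kernelFamily_diag` (W1) / `exists_admissible_mixed_of_kernelFamily_diag` (W3 = the wall
`mixed_two_torus_W3`'s conclusion) with the kernel-level hypothesis in place of the displayed equivariance.
STRUCTURAL binders (true for the intended objects, displayed because `RTFData` carries an arbitrary measurable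
structure on the torus): `[MeasurableMul (torusT' W)]` and the right invariance of `μ_{T′}` (`[IsMulRightInvariant]`,
or `hR : R.IsHaar` + commutativity of `T′(𝔸)` through `isMulRightInvariant_of_comm`).

HC_CM is NOT proved by anyone in this repository.
-/

set_option autoImplicit false

noncomputable section

namespace Summit.Ventures.HodgeRepro.Tier4.Line4

open Summit.Ventures.HodgeRepro.Tier4.Common MeasureTheory NumberField

section Countable

variable {k : Type} [Field k] [NumberField k] (W : PlaneData k)

/-- A number field is countable (a finite-dimensional `ℚ`-space). -/
theorem countable_numberField : Countable k :=
  Finsupp.Countable.of_moduleFinite (R := ℚ)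

/-- `GL₄(k)` is countable. -/
theorem countable_GL4_rat : Countable (GL (Fin 4) k) := by
  haveI : Countable k := countable_numberField (k := k)
  haveI : Countable (Matrix (Fin 4) (Fin 4) k) := inferInstanceAs (Countable (Fin 4 → Fin 4 → k))
  exact Units.val_injective.countable

/-- The principal adelic matrices form a countable subgroup. -/
theorem countable_principalGL : Countable (principalGL (k := k)) := by
  haveI : Countable (GL (Fin 4) k) := countable_GL4_rat (k := k)
  have h : Set.Countable (Set.range (Matrix.GeneralLinearGroup.map (algebraMap k (Ad k)))) :=
    Set.countable_range (ι := GL (Fin 4) k) _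
  have e : ((principalGL (k := k) : Subgroup (GL4 k)) : Set (GL4 k)) =
      Set.range (Matrix.GeneralLinearGroup.map (algebraMap k (Ad k))) := MonoidHom.coe_range _
  rw [← Set.countable_coe_iff] at h
  rw [← SetLike.coe_sort_coe, e]
  exact h

/-- **The rational points `G(k)` are countable.** -/
theorem countable_rationalPoints : Countable (rationalPoints W) := by
  haveI : Countable (principalGL (k := k)) := countable_principalGL (k := k)
  refine Function.Injective.countable (f := fun x : rationalPoints W => (⟨(x : GA W), x.2⟩ : principalGL (k := k))) ?_
  intro x y hxy
  simp only [Subtype.mk.injEq] at hxy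
  exact Subtype.ext (Subtype.ext hxy)

/-- **The rational points of any subgroup `S ≤ G(𝔸_k)` are countable.** -/
theorem countable_rationalOf (S : Subgroup (GA W)) : Countable (rationalOf W S) := by
  haveI : Countable (rationalPoints W) := countable_rationalPoints W
  refine Function.Injective.countable (f := fun x : rationalOf W S => (⟨(x : S), x.2⟩ : rationalPoints W)) ?_
  intro x y hxy
  simp only [Subtype.mk.injEq] at hxy
  exact Subtype.ext (Subtype.ext hxy)

end Countable

section ChangeOfVariables

variable {k : Type} [Field k] [NumberField k] {W : PlaneData k} [MeasurableSpace (torusT' W)]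

/-- Left invariance plus commutativity give right invariance (the tori are abelian). -/
theorem isMulRightInvariant_of_comm (μ : Measure (torusT' W)) [μ.IsMulLeftInvariant]
    (hcomm : ∀ s t : torusT' W, s * t = t * s) : μ.IsMulRightInvariant := by
  refine ⟨fun c => ?_⟩
  have h : (fun t : torusT' W => t * c) = fun t => c * t := funext fun t => hcomm t c
  rw [h]
  exact map_mul_left_eq_self μ c

/-- **A right translate of a fundamental domain of `T′(k)` in `T′(𝔸)` is a fundamental domain** (right translation
commutes with the left action of the rational points and preserves a right-invariant measure). -/
theorem isFundamentalDomain_image_mulRight [MeasurableMul (torusT' W)] (μ : Measure (torusT' W))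
    [μ.IsMulRightInvariant] {D : Set (torusT' W)} (hD : IsFundamentalDomain (rationalOf W (torusT' W)) D μ)
    (c : torusT' W) : IsFundamentalDomain (rationalOf W (torusT' W)) ((fun t => t * c) '' D) μ := by
  refine hD.image_of_equiv (Equiv.mulRight c) ?_ (Equiv.refl _) ?_
  · exact (measurePreserving_mul_right μ c⁻¹).quasiMeasurePreserving
  · intro δ t
    show (δ • t) * c = δ • (t * c)
    simp only [Subgroup.smul_def, smul_eq_mul, mul_assoc]

/-- **The change of variables `t ↦ t c` on `[T′]`**: for a `T′(k)`-invariant integrand the integral over a fundamental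
domain is invariant under right translation of the variable. -/
theorem setIntegral_mul_right_of_fundamentalDomain [MeasurableMul (torusT' W)] (μ : Measure (torusT' W))
    [μ.IsMulLeftInvariant] [μ.IsMulRightInvariant] {D : Set (torusT' W)} (hD : IsFundamentalDomain (rationalOf W (torusT' W)) D μ)
    (c : torusT' W) {φ : torusT' W → ℂ}
    (hφ : ∀ (δ : rationalOf W (torusT' W)) (t : torusT' W), φ ((δ : torusT' W) * t) = φ t) :
    ∫ t in D, φ (t * c) ∂μ = ∫ t in D, φ t ∂μ := by
  haveI : Countable (rationalOf W (torusT' W)) := countable_rationalOf W _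
  haveI : MeasurableConstSMul (rationalOf W (torusT' W)) (torusT' W) :=
    ⟨fun δ => by
      have : (fun t : torusT' W => δ • t) = fun t => (δ : torusT' W) * t := funext fun t => Subgroup.smul_def δ t
      rw [this]
      exact measurable_const_mul _⟩
  haveI : SMulInvariantMeasure (rationalOf W (torusT' W)) (torusT' W) μ :=
    ⟨fun δ s _ => by
      have : ((fun t : torusT' W => δ • t) ⁻¹' s) = (fun t => (δ : torusT' W) * t) ⁻¹' s := by
        ext t
        simp only [Set.mem_preimage, Subgroup.smul_def, smul_eq_mul]
      rw [this]
      exact measure_preimage_mul μ _ s⟩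
  have h1 : ∫ t in D, φ (t * c) ∂μ = ∫ s in (fun t => t * c) '' D, φ s ∂μ :=
    ((measurePreserving_mul_right μ c).setIntegral_image_emb (MeasurableEquiv.mulRight c).measurableEmbedding φ
      D).symm
  rw [h1]
  exact (isFundamentalDomain_image_mulRight μ hD c).setIntegral_eq hD fun δ t => hφ δ t

end ChangeOfVariables

section Equivariance

variable {k : Type} [Field k] [NumberField k] {W : PlaneData k}
  [MeasurableSpace (torusT W)] [MeasurableSpace (torusT' W)] (R : RTFData W)

/-- `χ̄′` is multiplicative. -/
theorem conjChar_chi'_mul (s t : torusT' W) :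
    conjChar W R.chi' (s * t) = conjChar W R.chi' s * conjChar W R.chi' t := by
  simp only [conjChar, R.chi'_mul, map_mul]

/-- `χ̄′` is trivial on `T′(k)`. -/
theorem conjChar_chi'_rational (δ : rationalOf W (torusT' W)) : conjChar W R.chi' (δ : torusT' W) = 1 := by
  have hδ : ((δ : torusT' W) : GA W) ∈ rationalPoints W := Subgroup.mem_subgroupOf.1 δ.2
  simp only [conjChar, R.chi'_rational _ hδ, map_one]

/-- **Diagonal invariance of the kernel ⟹ `χ̄′`-equivariance of the lift** (the Riesz-vector argument): if
`Θ(t c, g c) = Θ(t, g)` for all `t, c ∈ T′(𝔸)`, `g ∈ G(𝔸)`, and `Θ` is `T′(k)`-invariant in `t`, then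
`θ(χ̄′)(x c) = χ̄′(c) θ(χ̄′)(x)`.  Structural binders: `MeasurableMul (torusT' W)` and the right invariance of `μ_{T′}`. -/
theorem thetaLift_mul_torus_of_diag [MeasurableMul (torusT' W)] [R.μT'.IsMulLeftInvariant]
    [R.μT'.IsMulRightInvariant]
    {Θ : torusT' W → GA W → ℂ}
    (hinv : ∀ (δ : rationalOf W (torusT' W)) (t : torusT' W) (g : GA W), Θ ((δ : torusT' W) * t) g = Θ t g)
    (hdiag : ∀ (t c : torusT' W) (g : GA W), Θ (t * c) (g * c) = Θ t g) (x : GA W) (c : torusT' W) :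
    thetaLift R.μT' R.DT' (conjChar W R.chi') Θ (x * c) =
      conjChar W R.chi' c * thetaLift R.μT' R.DT' (conjChar W R.chi') Θ x := by
  -- the integrand at `t` is `Θ(t c⁻¹, x) χ̄′(t c⁻¹) χ̄′(c)`
  have hpt : ∀ t : torusT' W, Θ t (x * c) * conjChar W R.chi' t =
      conjChar W R.chi' c * (Θ (t * c⁻¹) x * conjChar W R.chi' (t * c⁻¹)) := by
    intro t
    have h1 : Θ t (x * c) = Θ (t * c⁻¹) x := by
      conv_lhs => rw [← inv_mul_cancel_right t c, hdiag (t * c⁻¹) c x]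
    have h2 : conjChar W R.chi' t = conjChar W R.chi' (t * c⁻¹) * conjChar W R.chi' c := by
      rw [← conjChar_chi'_mul, inv_mul_cancel_right]
    rw [h1, h2]
    ring
  -- the function `s ↦ Θ(s, x) χ̄′(s)` is `T′(k)`-invariant
  have hφ : ∀ (δ : rationalOf W (torusT' W)) (t : torusT' W),
      Θ ((δ : torusT' W) * t) x * conjChar W R.chi' ((δ : torusT' W) * t) = Θ t x * conjChar W R.chi' t := by
    intro δ t
    rw [hinv, conjChar_chi'_mul, conjChar_chi'_rational, one_mul]
  simp only [thetaLift]
  simp only [hpt]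
  rw [integral_const_mul]
  congr 1
  exact setIntegral_mul_right_of_fundamentalDomain R.μT' R.DT'_fund c⁻¹
    (φ := fun s => Θ s x * conjChar W R.chi' s) hφ

/-- **The Riesz vector from a diagonally invariant kernel**: a kernel of the family with `Θ(t c, g c) = Θ(t, g)` and
`θ(χ̄′)(1) ≠ 0` is a Riesz vector of `V = thetaSpan F μ_{T′} D_{T′} χ̄′`. -/
theorem isRieszVector_thetaLift_of_diag [MeasurableMul (torusT' W)] [R.μT'.IsMulLeftInvariant]
    [R.μT'.IsMulRightInvariant]
    (F : KernelFamily W) {Θ : torusT' W → GA W → ℂ} (hΘ : Θ ∈ F.carrier)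
    (hdiag : ∀ (t c : torusT' W) (g : GA W), Θ (t * c) (g * c) = Θ t g)
    (h1 : thetaLift R.μT' R.DT' (conjChar W R.chi') Θ 1 ≠ 0) :
    IsRieszVector W R (thetaSpan F R.μT' R.DT' (conjChar W R.chi'))
      (thetaLift R.μT' R.DT' (conjChar W R.chi') Θ) :=
  ⟨thetaLift_mem_thetaSpan F _ _ _ hΘ, thetaLift_ne_zero_of_apply_ne_zero _ _ _ _ h1,
    fun x c => thetaLift_mul_torus_of_diag R (F.torus_invariant Θ hΘ) hdiag x c, h1⟩

variable (F : KernelFamily W) (q : QuadData k) (g g' : Matrix (Fin 4) (Fin 4) k) (w₀ : InfinitePlace k)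
  (eP eM eP' eM' : InfinitePlace k → ℤ)

/-- **RUNG W1 with the kernel-level hypothesis**: as `exists_admissible_riesz_of_kernelFamily`, with the equivariance
of the lift replaced by the DIAGONAL invariance of a kernel with `θ(χ̄′)(1) ≠ 0`. -/
theorem exists_admissible_riesz_of_kernelFamily_diag [MeasurableMul (torusT' W)] [R.μT'.IsMulLeftInvariant]
    [R.μT'.IsMulRightInvariant]
    (hriesz : ∃ Θ ∈ F.carrier, (∀ (t c : torusT' W) (g : GA W), Θ (t * c) (g * c) = Θ t g) ∧
      thetaLift R.μT' R.DT' (conjChar W R.chi') Θ 1 ≠ 0)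
    (hirr : ∀ V₀ ≤ thetaSpan F R.μT' R.DT' (conjChar W R.chi'), IsAutomorphicSubspace W V₀ →
      V₀ = ⊥ ∨ V₀ = thetaSpan F R.μT' R.DT' (conjChar W R.chi'))
    (hcusp : IsCuspidalSubspace W (thetaSpan F R.μT' R.DT' (conjChar W R.chi')))
    (hK : ∀ w, ∃ Θ ∈ F.carrier, thetaLift R.μT' R.DT' (conjChar W R.chi') Θ ≠ 0 ∧
      ∀ (x κ : GA W), κ ∈ localTorusAt W w → ∀ t,
        Θ t (x * κ) = weightAt W q w 0 κ ^ eP w * weightAt W q w 1 κ ^ eM w * Θ t x)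
    (hlow : ∀ j : ℤ, |(eP w₀ - eM w₀) + 2 * j| < 3 →
      ¬ HasKTypeAt W q w₀ (eP w₀ + j) (eM w₀ - j) (thetaSpan F R.μT' R.DT' (conjChar W R.chi')))
    (hK' : ∀ w, ∃ Θ ∈ F.carrier, thetaLift R.μT' R.DT' (conjChar W R.chi') Θ ≠ 0 ∧
      ∀ (x κ : GA W), κ ∈ localTorusAt' W w → ∀ t,
        Θ t (x * κ) = weightAt' W q w g g' 0 κ ^ eP' w * weightAt' W q w g g' 1 κ ^ eM' w * Θ t x)
    (hlow' : ∀ j : ℤ, |(eP' w₀ - eM' w₀) + 2 * j| < 3 →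
      ¬ HasKTypeAt' W q w₀ g g' (eP' w₀ + j) (eM' w₀ - j) (thetaSpan F R.μT' R.DT' (conjChar W R.chi'))) :
    ∃ V : Submodule ℂ (GA W → ℂ), IsAdmissible W q g g' w₀ eP eM eP' eM' V ∧ ∃ f, IsRieszVector W R V f := by
  obtain ⟨Θ, hΘ, hdiag, h1⟩ := hriesz
  exact ⟨thetaSpan F R.μT' R.DT' (conjChar W R.chi'),
    isAdmissible_thetaSpan R F q g g' w₀ eP eM eP' eM' hΘ (thetaLift_ne_zero_of_apply_ne_zero _ _ _ _ h1) hirr hcusp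
      hK hlow hK' hlow',
    _, isRieszVector_thetaLift_of_diag R F hΘ hdiag h1⟩

/-- **RUNG W3 (= the wall `mixed_two_torus_W3`'s conclusion) with the kernel-level hypothesis**: a diagonally invariant
kernel with `θ(χ̄′)(1) ≠ 0` and non-zero `T`-period of its lift against `χ` (the two-torus period of the kernel,
`mixedPeriod_thetaLift_eq`), plus the displayed spectral properties (ii)–(vii) of the family. -/
theorem exists_admissible_mixed_of_kernelFamily_diag [MeasurableMul (torusT' W)] [R.μT'.IsMulLeftInvariant]
    [R.μT'.IsMulRightInvariant]
    (hmixed : ∃ Θ ∈ F.carrier, (∀ (t c : torusT' W) (g : GA W), Θ (t * c) (g * c) = Θ t g) ∧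
      thetaLift R.μT' R.DT' (conjChar W R.chi') Θ 1 ≠ 0 ∧
      periodLin W R.μT R.DT R.chi (restrictTo W (torusT W) (thetaLift R.μT' R.DT' (conjChar W R.chi') Θ)) ≠ 0)
    (hirr : ∀ V₀ ≤ thetaSpan F R.μT' R.DT' (conjChar W R.chi'), IsAutomorphicSubspace W V₀ →
      V₀ = ⊥ ∨ V₀ = thetaSpan F R.μT' R.DT' (conjChar W R.chi'))
    (hcusp : IsCuspidalSubspace W (thetaSpan F R.μT' R.DT' (conjChar W R.chi')))
    (hK : ∀ w, ∃ Θ ∈ F.carrier, thetaLift R.μT' R.DT' (conjChar W R.chi') Θ ≠ 0 ∧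
      ∀ (x κ : GA W), κ ∈ localTorusAt W w → ∀ t,
        Θ t (x * κ) = weightAt W q w 0 κ ^ eP w * weightAt W q w 1 κ ^ eM w * Θ t x)
    (hlow : ∀ j : ℤ, |(eP w₀ - eM w₀) + 2 * j| < 3 →
      ¬ HasKTypeAt W q w₀ (eP w₀ + j) (eM w₀ - j) (thetaSpan F R.μT' R.DT' (conjChar W R.chi')))
    (hK' : ∀ w, ∃ Θ ∈ F.carrier, thetaLift R.μT' R.DT' (conjChar W R.chi') Θ ≠ 0 ∧
      ∀ (x κ : GA W), κ ∈ localTorusAt' W w → ∀ t,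
        Θ t (x * κ) = weightAt' W q w g g' 0 κ ^ eP' w * weightAt' W q w g g' 1 κ ^ eM' w * Θ t x)
    (hlow' : ∀ j : ℤ, |(eP' w₀ - eM' w₀) + 2 * j| < 3 →
      ¬ HasKTypeAt' W q w₀ g g' (eP' w₀ + j) (eM' w₀ - j) (thetaSpan F R.μT' R.DT' (conjChar W R.chi'))) :
    ∃ V : Submodule ℂ (GA W → ℂ), IsAdmissible W q g g' w₀ eP eM eP' eM' V ∧ HasNonzeroMixedPeriod W R V := by
  obtain ⟨Θ, hΘ, hdiag, h1, hper⟩ := hmixed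
  exact ⟨thetaSpan F R.μT' R.DT' (conjChar W R.chi'),
    isAdmissible_thetaSpan R F q g g' w₀ eP eM eP' eM' hΘ (thetaLift_ne_zero_of_apply_ne_zero _ _ _ _ h1) hirr hcusp
      hK hlow hK' hlow',
    _, isRieszVector_thetaLift_of_diag R F hΘ hdiag h1, hper⟩

/-- **The equivariance from the wall's own binders**: `hR : R.IsHaar` (left invariance of `μ_{T′}`) and the
commutativity of `T′(𝔸)` (the torus is abelian) replace the two invariance instances. -/
theorem thetaLift_mul_torus_of_diag_of_isHaar [MeasurableMul (torusT' W)] (hR : R.IsHaar)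
    (hcomm : ∀ s t : torusT' W, s * t = t * s) {Θ : torusT' W → GA W → ℂ}
    (hinv : ∀ (δ : rationalOf W (torusT' W)) (t : torusT' W) (g : GA W), Θ ((δ : torusT' W) * t) g = Θ t g)
    (hdiag : ∀ (t c : torusT' W) (g : GA W), Θ (t * c) (g * c) = Θ t g) (x : GA W) (c : torusT' W) :
    thetaLift R.μT' R.DT' (conjChar W R.chi') Θ (x * c) =
      conjChar W R.chi' c * thetaLift R.μT' R.DT' (conjChar W R.chi') Θ x := by
  haveI : R.μT'.IsHaarMeasure := hR.2.1
  haveI : R.μT'.IsMulRightInvariant := isMulRightInvariant_of_comm R.μT' hcomm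
  exact thetaLift_mul_torus_of_diag R hinv hdiag x c

/-- **RUNG W3 from the wall's binders** (`hR : R.IsHaar`, commutativity of `T′(𝔸)`, `MeasurableMul`): the conclusion
of `mixed_two_torus_W3` from a kernel family with the kernel-level hypotheses. -/
theorem exists_admissible_mixed_of_kernelFamily_isHaar [MeasurableMul (torusT' W)] (hR : R.IsHaar)
    (hcomm : ∀ s t : torusT' W, s * t = t * s)
    (hmixed : ∃ Θ ∈ F.carrier, (∀ (t c : torusT' W) (g : GA W), Θ (t * c) (g * c) = Θ t g) ∧
      thetaLift R.μT' R.DT' (conjChar W R.chi') Θ 1 ≠ 0 ∧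
      periodLin W R.μT R.DT R.chi (restrictTo W (torusT W) (thetaLift R.μT' R.DT' (conjChar W R.chi') Θ)) ≠ 0)
    (hirr : ∀ V₀ ≤ thetaSpan F R.μT' R.DT' (conjChar W R.chi'), IsAutomorphicSubspace W V₀ →
      V₀ = ⊥ ∨ V₀ = thetaSpan F R.μT' R.DT' (conjChar W R.chi'))
    (hcusp : IsCuspidalSubspace W (thetaSpan F R.μT' R.DT' (conjChar W R.chi')))
    (hK : ∀ w, ∃ Θ ∈ F.carrier, thetaLift R.μT' R.DT' (conjChar W R.chi') Θ ≠ 0 ∧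
      ∀ (x κ : GA W), κ ∈ localTorusAt W w → ∀ t,
        Θ t (x * κ) = weightAt W q w 0 κ ^ eP w * weightAt W q w 1 κ ^ eM w * Θ t x)
    (hlow : ∀ j : ℤ, |(eP w₀ - eM w₀) + 2 * j| < 3 →
      ¬ HasKTypeAt W q w₀ (eP w₀ + j) (eM w₀ - j) (thetaSpan F R.μT' R.DT' (conjChar W R.chi')))
    (hK' : ∀ w, ∃ Θ ∈ F.carrier, thetaLift R.μT' R.DT' (conjChar W R.chi') Θ ≠ 0 ∧
      ∀ (x κ : GA W), κ ∈ localTorusAt' W w → ∀ t,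
        Θ t (x * κ) = weightAt' W q w g g' 0 κ ^ eP' w * weightAt' W q w g g' 1 κ ^ eM' w * Θ t x)
    (hlow' : ∀ j : ℤ, |(eP' w₀ - eM' w₀) + 2 * j| < 3 →
      ¬ HasKTypeAt' W q w₀ g g' (eP' w₀ + j) (eM' w₀ - j) (thetaSpan F R.μT' R.DT' (conjChar W R.chi'))) :
    ∃ V : Submodule ℂ (GA W → ℂ), IsAdmissible W q g g' w₀ eP eM eP' eM' V ∧ HasNonzeroMixedPeriod W R V := by
  haveI : R.μT'.IsHaarMeasure := hR.2.1
  haveI : R.μT'.IsMulRightInvariant := isMulRightInvariant_of_comm R.μT' hcomm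
  exact exists_admissible_mixed_of_kernelFamily_diag R F q g g' w₀ eP eM eP' eM' hmixed hirr hcusp hK hlow hK' hlow'

end Equivariance

end Summit.Ventures.HodgeRepro.Tier4.Line4

end
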